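import Summits.BirchSwinnertonDyer.Rank1Residual.Eisenstein.K5Leaf
import Summits.BirchSwinnertonDyer.Rank1Residual.X1.KellerYinTheoremAClass
import Summits.BirchSwinnertonDyer.Rank1Residual.X1.ClassClosureN1
import Summits.BirchSwinnertonDyer.Rank1Residual.X1.PadicSigmaThreeExistence
import Summits.BirchSwinnertonDyer.Rank1Residual.X2.RankOne
import Summits.BirchSwinnertonDyer.Rank1Residual.X2.Cells
import Summits.BirchSwinnertonDyer.BirchSwinnertonDyer.Theorems.Rank1ResidualX1Defs
import HarnessLib

/-!
# Rung K5 (`EisensteinPrimes`): the leaf from its five open inputs and the published facts, BY NAME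

Theorems-side bridge for the ledger route `EisensteinPrimes` (D-0059 / D-0061; cell `bsd-eis`,
`run/shared/lean/pub/bsd-eis/TARGET.md` v1.8.11). Route files may import only `Literature`,
`HarnessLib`, the Statement and `Theorems/*`, while the class assemblies of the residual Eisenstein
programme live under `Summits/BirchSwinnertonDyer/Rank1Residual/`; this module imports them and
proves, once, the kernel certificate the route's deciding theorem applies:

* `eisensteinPrimes_of_inputs` — the rung-K5 leaf
  `Summit.BirchSwinnertonDyer.Rank1Residual.Eisenstein.EisensteinPrimes := BSDpOnClassX1 ∧ X2.Target`
  (p404820) follows from the FIVE open inputs, one per ladder row — Keller–Yin Thm 3.0.8 at the good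
  lattice (A1), Mazur's main conjecture on every X2b pair (A10), the X2c rank-one display (B11),
  Mazur's main conjecture on X1 in analytic rank 0 (A3), Schneider's conjecture for the canonical
  height on X1 type B in rank 1 (A2) — and twenty PUBLISHED named facts, through the class theorems
  already in the tree: `Rank1ResidualX1Defs.bsdp_of_classX1_of_analyticRank_eq_zero`,
  `X1.bsdp_of_typeBRankOne_of_schneider` (σ-existence PROVED:
  `X1.PadicSigmaThree.mazur_tate_sigma_exists_odd_holds`),
  `X1.KellerYinTheoremA.forall_bsdp_classX1_typeA_rankOne` (p403478) and
  `X2.target_of_published_of_missingInputB_of_rankOneDisplay`.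

Nothing is asserted: every input is a hypothesis by name. [cite: KellerYin2024, Thm A, Thm 3.0.8]
[cite: GreenbergVatsal2000, Thm 1.3] [cite: Miller2011LMS, Def 1.1]
-/

set_option autoImplicit false
set_option linter.dupNamespace false

namespace Summit.BirchSwinnertonDyer.BirchSwinnertonDyer.Theorems.EisensteinPrimesInputs

open Summit.BirchSwinnertonDyer.BirchSwinnertonDyer.Theorems.Rank1ResidualX1Defs
  Summit.BirchSwinnertonDyer.Rank1Residual
  Literature.NumberTheory.EllipticCurves Literature.NumberTheory.EllipticCurves.Rank1Residual
  Literature.NumberTheory.EllipticCurves.ModularForms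
  Literature.NumberTheory.EllipticCurves.CastellaGrossiLeeSkinner2022
  Literature.NumberTheory.EllipticCurves.Wuthrich2014 Literature.NumberTheory.EllipticCurves.SteinWuthrich2013
  Literature.NumberTheory.EllipticCurves.KellerYin2024

/-- **Rung K5 from its inputs.** The leaf `EisensteinPrimes` (= `BSDpOnClassX1 ∧ X2.Target`: the
`p`-part of BSD at every residual Eisenstein pair of analytic rank `≤ 1` in the classes X1 and X2)
follows from the five open inputs `h308` (A1), `hMCB` (A10), `hDisp` (B11), `hMC0` (A3), `hSch` (A2)
and the displayed PUBLISHED facts. X1, rank 0: `bsdp_of_classX1_of_analyticRank_eq_zero`; X1, rank 1,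
type B: `X1.bsdp_of_typeBRankOne_of_schneider`; X1, rank 1, type A: Keller–Yin Theorem A on the class;
X2: `X2.target_of_published_of_missingInputB_of_rankOneDisplay`. [cite: KellerYin2024, Thm A]
[cite: GreenbergVatsal2000, Thm 1.3] -/
theorem eisensteinPrimes_of_inputs
    (h308 : KellerYin2024.thm308_imc2_bdpValue_goodLattice_OPEN)
    (hMCB : ∀ (W : WeierstrassCurve ℚ) [W.IsElliptic] [W.IsGloballyMinimal] (p : ℕ) [Fact p.Prime],
      X2.CellB W p → X2.MazurMainConjectureAt W p)
    (hDisp : X2.RankOneDisplay)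
    (hMC0 : ∀ (W : WeierstrassCurve ℚ) [W.IsElliptic] [W.IsGloballyMinimal] (p : ℕ) [Fact p.Prime],
      ClassX1 W p → W.analyticRank = 0 → MazurMainConjecture W p)
    (hSch : ∀ (W : WeierstrassCurve ℚ) [W.IsElliptic] [W.IsGloballyMinimal] (p : ℕ) [Fact p.Prime],
      X1.TypeBRankOne W p → ∀ Dh : WeierstrassCurve.PAdicHeightData W p, Dh.IsCanonical →
        WeierstrassCurve.SchneiderConjecture Dh)
    (h511 : thm511_anticyclotomicControl_of_torsionFree)
    (hCassels : WeierstrassCurve.bsdRHS_eq_of_isIsogenous)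
    (hGV : GreenbergVatsal2000.thm13_charIdeal_eq_of_gvPar) (hGr : greenberg_charValue_rankZero)
    (hmodP : nonempty_modularParametrizationData) (hmod : exists_isNewformOf)
    (hHL : HoffsteinLuo1997_exists_twist_L_one_ne_zero) (hGZQ : GrossZagier1986_thm_I_7_3)
    (hGZ : ∀ (N : ℕ) [NeZero N] (W : WeierstrassCurve ℚ) (K : Type) [Field K] [NumberField K],
      gross_zagier N W K)
    (hKo : ∀ (N : ℕ) [NeZero N] (W : WeierstrassCurve ℚ) (K : Type) [Field K] [NumberField K],
      kolyvagin N W K)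
    (hGZK : rank_eq_analyticRank_of_analyticRank_le_one)
    (hS : Schneider1985_order_charGenerator_odd) (hPR : perrinRiou_rankOne_leadingTerms_odd)
    (hGVm : GreenbergVatsal2000.lambdaMu_multiplicative_of_gvPar)
    (hWu : thm16_charIdeal_dvd_multiplicative_of_reducible)
    (hJs : thm61_splitMultiplicative) (hJn : thm61_nonsplitMultiplicative)
    (hHs : exists_isSplitMultCanonical) (hHn : exists_isMultCanonical)
    (hGS : ∀ (W : WeierstrassCurve ℚ) [W.IsElliptic] [W.IsGloballyMinimal] (p : ℕ) [Fact p.Prime],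
      greenberg_stevens (W := W) (p := p)) :
    Rank1Residual.Eisenstein.EisensteinPrimes := by
  refine ⟨?_, ?_⟩
  · intro W _ _ p _ hX1 hr
    rcases Nat.le_one_iff_eq_zero_or_eq_one.mp hr with h0 | hr1
    · exact Rank1ResidualX1Defs.bsdp_of_classX1_of_analyticRank_eq_zero hGr hmodP hGZK W p hX1 h0
        (hMC0 W p hX1 h0)
    · by_cases hgv : GVPar W p
      · exact X1.bsdp_of_typeBRankOne_of_schneider hGV hS hPR
          X1.PadicSigmaThree.mazur_tate_sigma_exists_odd_holds hmodP hGZK W p ⟨hX1, hr1, hgv⟩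
          (hSch W p ⟨hX1, hr1, hgv⟩)
      · exact X1.KellerYinTheoremA.forall_bsdp_classX1_typeA_rankOne h308 h511 hCassels hGV hGr hmodP
          hmod hHL hGZQ hGZ hKo hGZK W p hX1 hgv hr1
  · exact X2.target_of_published_of_missingInputB_of_rankOneDisplay hGVm hWu hJs hJn hHs hHn hGZK hmodP
      hGS hmod hHL hGZQ (fun W _ _ p _ hc ↦ hMCB W p hc) hDisp

/-- **Rung K5 from its inputs — `TargetC`-shaped X2c crux.** The same leaf `EisensteinPrimes`
with the X2c input taken as the sub-cell TARGET `X2.TargetC` (`BSD(E,p)` on every `CellC` pair: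
analytic rank `1`, class X2) instead of the typed anticyclotomic display `X2.RankOneDisplay`. The X1
conjunct is assembled exactly as in `eisensteinPrimes_of_inputs`; the X2 conjunct is
`X2.target_of_targets` with X2a PROVED from the published facts (`X2.targetA_of_published`), X2b from
Mazur's main conjecture at every `CellB` pair (`X2.targetB_of_missingInputB`) and X2c the hypothesis
`hC`. Use: a route whose rank-4 crux is `X2.TargetC` admits as closing lines both the display road
(`X2.targetC_of_rankOneDisplay_of_targetB`) and roads that conclude `BSDp` on sub-families of X2c
directly (e.g. `X2.NonsplitHalvesOnTree`). Nothing is asserted: every input is a hypothesis by name.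
[cite: KellerYin2024, Thm A] [cite: GreenbergVatsal2000, Thm 1.3] [cite: Miller2011LMS, Def 1.1] -/
theorem eisensteinPrimes_of_inputs_of_targetC
    (h308 : KellerYin2024.thm308_imc2_bdpValue_goodLattice_OPEN)
    (hMCB : ∀ (W : WeierstrassCurve ℚ) [W.IsElliptic] [W.IsGloballyMinimal] (p : ℕ) [Fact p.Prime],
      X2.CellB W p → X2.MazurMainConjectureAt W p)
    (hC : X2.TargetC)
    (hMC0 : ∀ (W : WeierstrassCurve ℚ) [W.IsElliptic] [W.IsGloballyMinimal] (p : ℕ) [Fact p.Prime],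
      ClassX1 W p → W.analyticRank = 0 → MazurMainConjecture W p)
    (hSch : ∀ (W : WeierstrassCurve ℚ) [W.IsElliptic] [W.IsGloballyMinimal] (p : ℕ) [Fact p.Prime],
      X1.TypeBRankOne W p → ∀ Dh : WeierstrassCurve.PAdicHeightData W p, Dh.IsCanonical →
        WeierstrassCurve.SchneiderConjecture Dh)
    (h511 : thm511_anticyclotomicControl_of_torsionFree)
    (hCassels : WeierstrassCurve.bsdRHS_eq_of_isIsogenous)
    (hGV : GreenbergVatsal2000.thm13_charIdeal_eq_of_gvPar) (hGr : greenberg_charValue_rankZero)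
    (hmodP : nonempty_modularParametrizationData) (hmod : exists_isNewformOf)
    (hHL : HoffsteinLuo1997_exists_twist_L_one_ne_zero) (hGZQ : GrossZagier1986_thm_I_7_3)
    (hGZ : ∀ (N : ℕ) [NeZero N] (W : WeierstrassCurve ℚ) (K : Type) [Field K] [NumberField K],
      gross_zagier N W K)
    (hKo : ∀ (N : ℕ) [NeZero N] (W : WeierstrassCurve ℚ) (K : Type) [Field K] [NumberField K],
      kolyvagin N W K)
    (hGZK : rank_eq_analyticRank_of_analyticRank_le_one)
    (hS : Schneider1985_order_charGenerator_odd) (hPR : perrinRiou_rankOne_leadingTerms_odd)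
    (hGVm : GreenbergVatsal2000.lambdaMu_multiplicative_of_gvPar)
    (hWu : thm16_charIdeal_dvd_multiplicative_of_reducible)
    (hJs : thm61_splitMultiplicative) (hJn : thm61_nonsplitMultiplicative)
    (hHs : exists_isSplitMultCanonical) (hHn : exists_isMultCanonical)
    (hGS : ∀ (W : WeierstrassCurve ℚ) [W.IsElliptic] [W.IsGloballyMinimal] (p : ℕ) [Fact p.Prime],
      greenberg_stevens (W := W) (p := p)) :
    Rank1Residual.Eisenstein.EisensteinPrimes := by
  refine ⟨?_, ?_⟩
  · intro W _ _ p _ hX1 hr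
    rcases Nat.le_one_iff_eq_zero_or_eq_one.mp hr with h0 | hr1
    · exact Rank1ResidualX1Defs.bsdp_of_classX1_of_analyticRank_eq_zero hGr hmodP hGZK W p hX1 h0
        (hMC0 W p hX1 h0)
    · by_cases hgv : GVPar W p
      · exact X1.bsdp_of_typeBRankOne_of_schneider hGV hS hPR
          X1.PadicSigmaThree.mazur_tate_sigma_exists_odd_holds hmodP hGZK W p ⟨hX1, hr1, hgv⟩
          (hSch W p ⟨hX1, hr1, hgv⟩)
      · exact X1.KellerYinTheoremA.forall_bsdp_classX1_typeA_rankOne h308 h511 hCassels hGV hGr hmodP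
          hmod hHL hGZQ hGZ hKo hGZK W p hX1 hgv hr1
  · have hmod' := WeierstrassCurve.hasEntireLFunction_rat_of_exists_isNewformOf hmod
    exact X2.target_of_targets (X2.targetA_of_published hGVm hWu hJs hJn hHs hHn hGZK hmod' hmodP hGS)
      (X2.targetB_of_missingInputB hJs hJn hHs hHn hGZK hmod' hmodP hGS (fun W _ _ p _ hc ↦ hMCB W p hc))
      hC

end Summit.BirchSwinnertonDyer.BirchSwinnertonDyer.Theorems.EisensteinPrimesInputs
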